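import Mathlib.Data.ZMod.Basic
import Mathlib.Algebra.Field.ZMod
import Mathlib.Data.Fintype.Card
import Mathlib.LinearAlgebra.Matrix.GeneralLinearGroup.Defs
import Mathlib.LinearAlgebra.Matrix.GeneralLinearGroup.Card
import Mathlib.LinearAlgebra.Matrix.Notation
import Mathlib.GroupTheory.PGroup
import Mathlib.GroupTheory.OrderOfElement
import Mathlib.GroupTheory.SpecificGroups.Cyclic
import Mathlib.GroupTheory.Subgroup.Centralizer
import Mathlib.Algebra.Group.Subgroup.Finite
import Mathlib.GroupTheory.Coset.Card
import HarnessLib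

/-!
# Subgroups of `GL₂(𝔽₅)` normalising a group of order `3` (BCDT 2001, §2.2, proof of Thm. 2.2.1)

Topic `NumberTheory/GaloisRepresentations`.  C. Breuil, B. Conrad, F. Diamond, R. Taylor, *On the
modularity of elliptic curves over `ℚ`: wild `3`-adic exercises*, J. Amer. Math. Soc. 14 (2001)
[BCDTJAMS2001], prove Theorem 2.2.1 (= Theorem B: every continuous absolutely irreducible
`ρ̄ : G_ℚ → GL₂(𝔽₅)` with cyclotomic determinant is modular) by first classifying `ρ̄|_{G₃}` (p. 860):
*"Choose an element `τ ∈ GL₂(𝔽₅)` with `τ³ = 1` but `τ ≠ 1`. (The following classification will be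
independent of the choice of `τ`.) Then up to equivalence and twisting by a quadratic character,
one of the following possibilities can be attained. 1. `ρ̄` is tamely ramified at `3`. 2.–6. …"* —
and the reduction to the six cases rests on three facts about the finite group `GL₂(𝔽₅)`, printed
on p. 860 as

> *"To see that one of these cases can be attained, use the following facts, all of which are easy
> to verify.*
> * *A subgroup of `GL₂(𝔽₅)` with a non-trivial normal subgroup of `3`-power order is, up to
>   conjugation, contained in the normaliser of `𝔽₅(τ)^×`.*
> * *The intersection of `SL₂(𝔽₅)` with the normaliser of `τ` in `GL₂(𝔽₅)` is generated by `τ` and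
>   an element `σ` such that `σ² = -1` and `στσ⁻¹ = τ⁻¹`.*
> * *If `α ∈ 𝔽₅(τ)^×`, `det α = 3`, and `σασ⁻¹ = -α`, then `α = ±(τ - τ⁻¹)`."*

(The first fact is applied to `ρ̄(G₃)`, whose normal subgroup `ρ̄(P₃)` — the image of wild inertia,
a pro-`3` group — is a non-trivial `3`-group exactly when `ρ̄` is wildly ramified at `3`, i.e. in
cases 2–6.)  This file PROVES the three facts, sorry-free and without named facts, for the choice
`τ = (0 -1; 1 -1)` (the companion matrix of `X² + X + 1`) and `σ = (0 2; 2 0)`, together with the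
independence of the choice of `τ` (any two elements of order `3` of `GL₂(𝔽₅)` are conjugate):

* `tau`, `sigma : GL (Fin 2) (ZMod 5)`; `tau_pow_three`, `tau_ne_one`, `orderOf_tau`, `sigma_sq`
  (`σ² = -1`), `sigma_mul_tau_mul_sigma_inv` (`στσ⁻¹ = τ⁻¹`);
* `exists_conj_eq_tau` — every `g ∈ GL₂(𝔽₅)` with `g³ = 1`, `g ≠ 1` is conjugate to `τ`
  (`isConj_of_pow_three_eq_one`: "independent of the choice of `τ`");
* `unitsF5Tau := Subgroup.centralizer {tau}` — this is how "`𝔽₅(τ)^×`" is rendered — and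
  `mem_unitsF5Tau_iff` — `𝔽₅(τ) = 𝔽₅ ⊕ 𝔽₅ τ`: the centraliser of `τ` in `GL₂(𝔽₅)` is exactly
  `{a + c τ}`; `mul_comm_of_mem_unitsF5Tau` (it is abelian), `mem_six_of_mem_unitsF5Tau_of_det_eq_one`
  (its elements of determinant `1` are `±1, ±τ, ±τ²`);
* `card_eq_three_of_isPGroup_three` — a non-trivial `3`-subgroup of `GL₂(𝔽₅)` (order `480`) has
  order `3`;
* **fact 1** `exists_conj_le_normalizer_unitsF5Tau` — if `H ≤ GL₂(𝔽₅)` normalises a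
  non-trivial `3`-subgroup `P` then for some `x`, `x H x⁻¹ ≤ N(𝔽₅(τ)^×)` and `x P x⁻¹ = ⟨τ⟩`; and its
  form for a homomorphism `ρ : D → GL₂(𝔽₅)` and a normal subgroup `P ⊴ D` with `ρ(P)` a non-trivial
  `3`-group (`exists_conj_apply_mem_normalizer_of_normal`, the shape in which it is applied to
  `D = G₃ ⊵ P₃`);
* **fact 2** `ker_det_inf_normalizer_zpowers_tau` — `SL₂(𝔽₅) ∩ N_{GL₂(𝔽₅)}(⟨τ⟩) = ⟨τ, σ⟩`;
* **fact 3** `eq_tau_sub_tau_inv_or_of_det_eq_three` — for `α ∈ 𝔽₅(τ)^×` with `det α = 3` and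
  `σ' α σ'⁻¹ = -α` for any `σ'` with `σ' τ σ'⁻¹ = τ⁻¹`: `α = ±(τ - τ⁻¹)`;
* (appendix) `mem_or_sigma_inv_mul_mem_of_mem_normalizer_unitsF5Tau` —
  `N(𝔽₅(τ)^×) = 𝔽₅(τ)^× ∪ σ𝔽₅(τ)^×` (index `2`: `sigma_mem_normalizer_unitsF5Tau`,
  `sigma_not_mem_unitsF5Tau`, `mul_mem_unitsF5Tau_of_not_mem_of_not_mem`), the split of BCDT's
  cases 2–6 into case 2 (image inside the Cartan) and cases 3–6 (an index-`2` subgroup mapping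
  into it).

## Method

Identities between explicit `2 × 2` matrices over `𝔽₅`, and the finitely many case distinctions
over `𝔽₅⁴` or `𝔽₅²` (e.g. "`g³ = 1 ⇒ g = 1` or `tr g = -1, det g = 1`"; "`g` commutes with `τ` iff
`g = a + cτ`"; "the elements of `𝔽₅(τ)^×` of determinant `1` are `±1, ±τ, ±τ²`"), are checked by
`decide` on a computational model `M2` (four entries of `ZMod 5`, as in
`Literature.NumberTheory.GaloisRepresentations.GL2F3Lift`), transported to `Matrix (Fin 2) (Fin 2) (ZMod 5)`
and `GL (Fin 2) (ZMod 5)` by `M2.toMat_mul`, `M2.toMat_injective`.  The conjugation of an element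
`g` of order `3` to `τ` is the explicit change of basis `(e₁, g e₁)` (`M2.basisMat`; `e₁` is never
an eigenvector since `X² + X + 1` has no root in `𝔽₅`); fact 1 is then the Sylow count
`9 ∤ 480 = #GL₂(𝔽₅)` (`Matrix.card_GL_field`) plus the general group-theoretic lemma
`mem_normalizer_centralizer_of_conj_mem_zpowers` (whoever normalises `⟨s⟩` normalises `C(s)`);
fact 2 reduces, after multiplying by `σ⁻¹` if necessary, to the list of determinant-`1` elements of
`𝔽₅(τ)^×`; fact 3 reduces to `σ' = σ` because `σ⁻¹σ'` centralises `τ` and `𝔽₅(τ)^×` is abelian.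

## Faithfulness notes

* "`𝔽₅(τ)^×`" is the unit group of the `𝔽₅`-subalgebra `𝔽₅[τ] ≅ 𝔽₂₅` of `M₂(𝔽₅)`; as a subgroup
  of `GL₂(𝔽₅)` it is the centraliser of `τ` (`unitsF5Tau`, `mem_unitsF5Tau_iff`), and "the
  normaliser of `τ`" is the normaliser of `⟨τ⟩` (`Subgroup.zpowers tau`); `SL₂(𝔽₅)` is the kernel
  of `Matrix.GeneralLinearGroup.det`.
* "A subgroup `H` with a non-trivial normal subgroup `P` of `3`-power order": `P ≠ ⊥`,
  `IsPGroup 3 P` (every element has `3`-power order, equivalently `#P = 3ᵏ`), and `H ≤ P.normalizer`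
  (the hypothesis `P ≤ H` is not needed and not assumed).
* The paper fixes an arbitrary `τ` of order `3`; here `τ` is a fixed matrix and the independence
  of the choice is the proved conjugacy `isConj_of_pow_three_eq_one`.  In fact 3 the element `σ`
  is any element inverting `τ` (as printed, `σ` being the element of fact 2).
* Nothing here is specific to Galois representations; the application to `ρ̄(G₃) ⊵ ρ̄(P₃)` is the
  purely group-theoretic `exists_conj_apply_mem_normalizer_of_normal`.

## What this feeds

The named fact `Literature.NumberTheory.Automorphic.BCDT.exists_isTorsionGaloisRep_and_isModular_of_not_isTamelyRamifiedAbove`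
(`Automorphic/BCDTTheoremB`: cases 2–6 of the proof of Thm. 2.2.1, the wild case) is the one piece
of Theorem B whose printed proof begins with this classification; the present file supplies its
finite-group input, so that a later decomposition of that fact along the printed cases 2–6 can
start from `exists_conj_apply_mem_normalizer_of_normal` applied to `ρ̄|_{G₃}` and the image of wild
inertia (a pro-`3` group, non-trivial exactly when `ρ̄` is not tamely ramified above `3`,
`FramedGaloisRep.IsTamelyRamifiedAbove`).

`lean search` / Mathlib (this pin): `Matrix.card_GL_field`, `IsPGroup`, `Subgroup.centralizer`,
`Subgroup.normalizer`, `MulAut.conj` exist; no classification of order-`3` elements or of these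
normalisers in `GL₂(𝔽_q)` exists in Mathlib or in the tree (`GL2F3Lift` treats `GL₂(𝔽₃)`).

## References

* [BCDTJAMS2001] C. Breuil, B. Conrad, F. Diamond, R. Taylor, J. Amer. Math. Soc. 14 (2001),
  843–939: §2.2, proof of Theorem 2.2.1, p. 860 (the three bulleted facts and the six cases).

## Design

Pure Mathlib imports; `namespace Literature.NumberTheory.GaloisRepresentations.GL2F5OrderThree`;
the only instance is `Fact (Nat.Prime 5)` (Mathlib registers `2` and `3` only), needed for the
field structure of `ZMod 5`.  No `sorry`, no named facts; axioms of every theorem ⊆ {`propext`,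
`Classical.choice`, `Quot.sound`}.
-/

namespace Literature.NumberTheory.GaloisRepresentations.GL2F5OrderThree

open Matrix

/-- `5` is prime (`Fact` instance for the field structure on `ZMod 5 = 𝔽₅`; Mathlib registers
`Nat.fact_prime_two`, `Nat.fact_prime_three` only). [folklore] -/
instance instFactNatPrimeFive : Fact (Nat.Prime 5) := ⟨Nat.prime_five⟩

/-! ## The computational model: `2 × 2` arrays over `𝔽₅` -/

/-- A `2 × 2` array `(a b; c d)` over `𝔽₅` with decidable equality, on which the finite case
distinctions of this file are checked by `decide`; `M2.toMat` turns it into a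
`Matrix (Fin 2) (Fin 2) (ZMod 5)`. [folklore] -/
structure M2 where
  /-- entry `(0,0)` -/
  a : ZMod 5
  /-- entry `(0,1)` -/
  b : ZMod 5
  /-- entry `(1,0)` -/
  c : ZMod 5
  /-- entry `(1,1)` -/
  d : ZMod 5
deriving DecidableEq

namespace M2

/-- Matrix product on the encoding. [folklore] -/
def mul (x y : M2) : M2 :=
  ⟨x.a * y.a + x.b * y.c, x.a * y.b + x.b * y.d, x.c * y.a + x.d * y.c, x.c * y.b + x.d * y.d⟩

/-- The identity matrix. [folklore] -/
def one : M2 := ⟨1, 0, 0, 1⟩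

/-- Negation. [folklore] -/
def neg (x : M2) : M2 := ⟨-x.a, -x.b, -x.c, -x.d⟩

/-- Determinant `a d - b c`. [folklore] -/
def det (x : M2) : ZMod 5 := x.a * x.d - x.b * x.c

/-- Trace `a + d`. [folklore] -/
def tr (x : M2) : ZMod 5 := x.a + x.d

/-- `τ = (0 -1; 1 -1)`, the companion matrix of `X² + X + 1` (an element of order `3`).
[cite: BCDTJAMS2001, §2.2 (proof of Thm. 2.2.1, p. 860)] -/
def tau : M2 := ⟨0, -1, 1, -1⟩

/-- `τ² = τ⁻¹ = (-1 1; -1 0)`. [folklore] -/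
def tauSq : M2 := ⟨-1, 1, -1, 0⟩

/-- `σ = (0 2; 2 0)`: `σ² = -1`, `στσ⁻¹ = τ⁻¹`, `det σ = 1`.
[cite: BCDTJAMS2001, §2.2 (proof of Thm. 2.2.1, p. 860)] -/
def sigma : M2 := ⟨0, 2, 2, 0⟩

/-- The element `a + c τ = (a -c; c a-c)` of `𝔽₅[τ] = 𝔽₅(τ) ≅ 𝔽₂₅`. [folklore] -/
def lin (a c : ZMod 5) : M2 := ⟨a, -c, c, a - c⟩

/-- The change-of-basis matrix with columns `e₁` and `x e₁`. [folklore] -/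
def basisMat (x : M2) : M2 := ⟨1, x.a, 0, x.c⟩

/-- The matrix encoded by `x`. [folklore] -/
def toMat (x : M2) : Matrix (Fin 2) (Fin 2) (ZMod 5) := !![x.a, x.b; x.c, x.d]

/-- The encoding of a matrix. [folklore] -/
def ofMat (g : Matrix (Fin 2) (Fin 2) (ZMod 5)) : M2 := ⟨g 0 0, g 0 1, g 1 0, g 1 1⟩

/-- `toMat ∘ ofMat = id`. [folklore] -/
theorem toMat_ofMat (g : Matrix (Fin 2) (Fin 2) (ZMod 5)) : toMat (ofMat g) = g :=
  (Matrix.eta_fin_two g).symm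

/-- `ofMat ∘ toMat = id`. [folklore] -/
theorem ofMat_toMat (x : M2) : ofMat (toMat x) = x := by
  cases x; rfl

/-- `toMat` is injective. [folklore] -/
theorem toMat_injective : Function.Injective toMat := fun x y h ↦ by
  rw [← ofMat_toMat x, ← ofMat_toMat y, h]

/-- `toMat` is multiplicative. [folklore] -/
theorem toMat_mul (x y : M2) : toMat (mul x y) = toMat x * toMat y := by
  simp only [toMat, mul, Matrix.mul_fin_two]

/-- `toMat 1 = 1`. [folklore] -/
theorem toMat_one : toMat one = 1 := by
  rw [Matrix.one_fin_two]; rfl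

/-- `toMat (-x) = -toMat x`. [folklore] -/
theorem toMat_neg (x : M2) : toMat (neg x) = -toMat x := by
  ext i j; fin_cases i <;> fin_cases j <;> rfl

/-- Determinants agree. [folklore] -/
theorem det_toMat (x : M2) : (toMat x).det = det x :=
  Matrix.det_fin_two_of _ _ _ _

/-- Traces agree. [folklore] -/
theorem trace_toMat (x : M2) : (toMat x).trace = tr x :=
  Matrix.trace_fin_two_of _ _ _ _

/-- `ofMat` is multiplicative. [folklore] -/
theorem ofMat_mul (g h : Matrix (Fin 2) (Fin 2) (ZMod 5)) : ofMat (g * h) = mul (ofMat g) (ofMat h) :=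
  toMat_injective (by rw [toMat_mul, toMat_ofMat, toMat_ofMat, toMat_ofMat])

/-- `a • 1 + c • τ = (a -c; c a-c)` as matrices: `𝔽₅[τ] = 𝔽₅ ⊕ 𝔽₅ τ`. [folklore] -/
theorem smul_one_add_smul_toMat_tau (a c : ZMod 5) :
    a • (1 : Matrix (Fin 2) (Fin 2) (ZMod 5)) + c • toMat tau = toMat (lin a c) := by
  ext i j
  fin_cases i <;> fin_cases j <;> simp [toMat, tau, lin, sub_eq_add_neg]

/-! ### The certificates (checked by `decide`) -/

/-- `τ τ² = 1`. [folklore] -/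
theorem tau_mul_tauSq : mul tau tauSq = one := by decide

/-- `τ² τ = 1`. [folklore] -/
theorem tauSq_mul_tau : mul tauSq tau = one := by decide

/-- `τ τ = τ²`. [folklore] -/
theorem tau_mul_tau : mul tau tau = tauSq := by decide

/-- `σ σ = -1`. [folklore] -/
theorem sigma_mul_sigma : mul sigma sigma = neg one := by decide

/-- `σ (-σ) = 1`. [folklore] -/
theorem sigma_mul_neg_sigma : mul sigma (neg sigma) = one := by decide

/-- `(-σ) σ = 1`. [folklore] -/
theorem neg_sigma_mul_sigma : mul (neg sigma) sigma = one := by decide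

/-- `σ τ = τ² σ` (i.e. `στσ⁻¹ = τ⁻¹`). [folklore] -/
theorem sigma_mul_tau : mul sigma tau = mul tauSq sigma := by decide

/-- `det τ = 1`. [folklore] -/
theorem det_tau : det tau = 1 := by decide

/-- `det σ = 1`. [folklore] -/
theorem det_sigma : det sigma = 1 := by decide

/-- `τ ≠ 1`. [folklore] -/
theorem tau_ne_one : tau ≠ one := by decide

/-- **`g³ = 1` in `M₂(𝔽₅)` forces `g = 1` or (`tr g = -1` and `det g = 1`)** (Cayley–Hamilton:
`g³ = (t² - d) g - t d` with `t = tr g`, `d = det g`; cubing is injective on `𝔽₅`). [folklore] -/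
theorem cube_cert : ∀ a b c d : ZMod 5,
    mul ⟨a, b, c, d⟩ (mul ⟨a, b, c, d⟩ ⟨a, b, c, d⟩) = one →
      (⟨a, b, c, d⟩ : M2) = one ∨ (a + d = -1 ∧ a * d - b * c = 1) := by
  decide

/-- **Change of basis to the companion matrix**: if `tr g = -1` and `det g = 1` (i.e.
`g² + g + 1 = 0`) then `e₁` is not an eigenvector (`X² + X + 1` has no root in `𝔽₅`), and in the
basis `(e₁, g e₁)` the matrix of `g` is `τ`: `g B = B τ` with `B = (e₁ | g e₁)` invertible. [folklore] -/
theorem conj_cert : ∀ a b c d : ZMod 5, a + d = -1 → a * d - b * c = 1 →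
    c ≠ 0 ∧ mul ⟨a, b, c, d⟩ (basisMat ⟨a, b, c, d⟩) = mul (basisMat ⟨a, b, c, d⟩) tau := by
  decide

/-- **The centraliser of `τ` in `M₂(𝔽₅)` is `𝔽₅[τ] = {a + cτ}`.** [folklore] -/
theorem comm_cert : ∀ a b c d : ZMod 5,
    mul ⟨a, b, c, d⟩ tau = mul tau ⟨a, b, c, d⟩ ↔ (b = -c ∧ d = a - c) := by
  decide

/-- `𝔽₅[τ]` is commutative. [folklore] -/
theorem lin_comm_cert : ∀ a c a' c' : ZMod 5, mul (lin a c) (lin a' c') = mul (lin a' c') (lin a c) := by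
  decide

/-- **The elements of `𝔽₅(τ)^×` of determinant (= norm) `1` are `±1, ±τ, ±τ²`** (`μ₆ ⊂ 𝔽₂₅^×`).
[folklore] -/
theorem det_one_cert : ∀ a c : ZMod 5, det (lin a c) = 1 →
    (a = 1 ∧ c = 0) ∨ (a = -1 ∧ c = 0) ∨ (a = 0 ∧ c = 1) ∨ (a = 0 ∧ c = -1) ∨
      (a = -1 ∧ c = -1) ∨ (a = 1 ∧ c = 1) := by
  decide

/-- The six elements of `det_one_cert` are `1, -1, τ, -τ, τ², -τ²`. [folklore] -/
theorem lin_six_cert :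
    lin 1 0 = one ∧ lin (-1) 0 = neg one ∧ lin 0 1 = tau ∧ lin 0 (-1) = neg tau ∧
      lin (-1) (-1) = tauSq ∧ lin 1 1 = neg tauSq := by
  decide

/-- **Fact 3 on the model**: `α = a + cτ` with `det α = 3` and `σ α = -α σ` is `±(1 + 2τ)`
(`σ` acts on `𝔽₂₅` as Frobenius, so `α` is "purely imaginary", `α = a(1 + 2τ)`, and
`det α = 3a²`). [folklore] -/
theorem fact3_cert : ∀ a c : ZMod 5, det (lin a c) = 3 → mul sigma (lin a c) = mul (neg (lin a c)) sigma →
    (a = 1 ∧ c = 2) ∨ (a = -1 ∧ c = -2) := by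
  decide

/-- `1 + 2τ = τ - τ⁻¹` and `-(1 + 2τ) = -(τ - τ⁻¹)` as matrices. [folklore] -/
theorem toMat_lin_one_two :
    toMat (lin 1 2) = toMat tau - toMat tauSq ∧ toMat (lin (-1) (-2)) = -(toMat tau - toMat tauSq) := by
  constructor <;> (ext i j; fin_cases i <;> fin_cases j <;> decide)

end M2

/-! ## The elements `τ`, `σ` of `GL₂(𝔽₅)` -/

/-- A unit of `M₂(𝔽₅)` from an encoded matrix and an encoded two-sided inverse. [folklore] -/
def toGL (x y : M2) (hxy : M2.mul x y = M2.one) (hyx : M2.mul y x = M2.one) : GL (Fin 2) (ZMod 5) :=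
  ⟨x.toMat, y.toMat, by rw [← M2.toMat_mul, hxy, M2.toMat_one], by rw [← M2.toMat_mul, hyx, M2.toMat_one]⟩

/-- **`τ = (0 -1; 1 -1) ∈ GL₂(𝔽₅)`**, an element with `τ³ = 1`, `τ ≠ 1` (BCDT: "Choose an element
`τ ∈ GL₂(𝔽₅)` with `τ³ = 1` but `τ ≠ 1`"). [cite: BCDTJAMS2001, §2.2 (proof of Thm. 2.2.1, p. 860)] -/
def tau : GL (Fin 2) (ZMod 5) :=
  toGL M2.tau M2.tauSq M2.tau_mul_tauSq M2.tauSq_mul_tau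

/-- **`σ = (0 2; 2 0) ∈ GL₂(𝔽₅)`**, an element with `σ² = -1`, `στσ⁻¹ = τ⁻¹` (and `det σ = 1`).
[cite: BCDTJAMS2001, §2.2 (proof of Thm. 2.2.1, p. 860)] -/
def sigma : GL (Fin 2) (ZMod 5) :=
  toGL M2.sigma (M2.neg M2.sigma) M2.sigma_mul_neg_sigma M2.neg_sigma_mul_sigma

/-- **`𝔽₅(τ)^× ≤ GL₂(𝔽₅)`**: the unit group of the subfield `𝔽₅(τ) = 𝔽₅[τ] ≅ 𝔽₂₅` of `M₂(𝔽₅)`,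
realised as the centraliser of `τ` in `GL₂(𝔽₅)` (`mem_unitsF5Tau_iff`: its elements are exactly the
invertible `a + cτ`; a non-split Cartan subgroup, of order `24`).
[cite: BCDTJAMS2001, §2.2 (proof of Thm. 2.2.1, p. 860)] -/
abbrev unitsF5Tau : Subgroup (GL (Fin 2) (ZMod 5)) :=
  Subgroup.centralizer {tau}

/-- The matrix of `τ`. [folklore] -/
theorem val_tau : ((tau : GL (Fin 2) (ZMod 5)) : Matrix (Fin 2) (Fin 2) (ZMod 5)) = M2.toMat M2.tau := rfl

/-- The matrix of `τ⁻¹` is `τ² = (-1 1; -1 0)`. [folklore] -/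
theorem val_tau_inv :
    ((tau⁻¹ : GL (Fin 2) (ZMod 5)) : Matrix (Fin 2) (Fin 2) (ZMod 5)) = M2.toMat M2.tauSq := rfl

/-- The matrix of `σ`. [folklore] -/
theorem val_sigma :
    ((sigma : GL (Fin 2) (ZMod 5)) : Matrix (Fin 2) (Fin 2) (ZMod 5)) = M2.toMat M2.sigma := rfl

/-- The matrix of `τ` is `(0 -1; 1 -1)`. [folklore] -/
theorem val_tau_eq : ((tau : GL (Fin 2) (ZMod 5)) : Matrix (Fin 2) (Fin 2) (ZMod 5)) = !![0, -1; 1, -1] :=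
  rfl

/-- The matrix of `τ⁻¹` is `(-1 1; -1 0)`. [folklore] -/
theorem val_tau_inv_eq :
    ((tau⁻¹ : GL (Fin 2) (ZMod 5)) : Matrix (Fin 2) (Fin 2) (ZMod 5)) = !![-1, 1; -1, 0] :=
  rfl

/-- The matrix of `σ` is `(0 2; 2 0)`. [folklore] -/
theorem val_sigma_eq : ((sigma : GL (Fin 2) (ZMod 5)) : Matrix (Fin 2) (Fin 2) (ZMod 5)) = !![0, 2; 2, 0] :=
  rfl

/-! ### Transport between `GL₂(𝔽₅)` and the model -/

/-- The encoding of the matrix of `g ∈ GL₂(𝔽₅)`. [folklore] -/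
abbrev enc (g : GL (Fin 2) (ZMod 5)) : M2 := M2.ofMat (g : Matrix (Fin 2) (Fin 2) (ZMod 5))

/-- `toMat (enc g) = g`. [folklore] -/
theorem toMat_enc (g : GL (Fin 2) (ZMod 5)) : (enc g).toMat = (g : Matrix (Fin 2) (Fin 2) (ZMod 5)) :=
  M2.toMat_ofMat _

/-- `enc` is multiplicative. [folklore] -/
theorem enc_mul (g h : GL (Fin 2) (ZMod 5)) : enc (g * h) = M2.mul (enc g) (enc h) := by
  rw [enc, Units.val_mul, M2.ofMat_mul]

/-- `enc` is injective. [folklore] -/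
theorem enc_injective : Function.Injective enc := fun g h hgh ↦
  Units.ext (by rw [← toMat_enc g, ← toMat_enc h, hgh])

/-- `enc 1 = 1`. [folklore] -/
theorem enc_one : enc 1 = M2.one :=
  M2.toMat_injective (by rw [toMat_enc, Units.val_one, M2.toMat_one])

/-- `enc (-g) = -enc g`. [folklore] -/
theorem enc_neg (g : GL (Fin 2) (ZMod 5)) : enc (-g) = M2.neg (enc g) :=
  M2.toMat_injective (by rw [toMat_enc, Units.val_neg, M2.toMat_neg, toMat_enc])

/-- `enc τ = τ`. [folklore] -/
theorem enc_tau : enc tau = M2.tau := M2.ofMat_toMat _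

/-- `enc τ⁻¹ = τ²`. [folklore] -/
theorem enc_tau_inv : enc tau⁻¹ = M2.tauSq := M2.ofMat_toMat _

/-- `enc σ = σ`. [folklore] -/
theorem enc_sigma : enc sigma = M2.sigma := M2.ofMat_toMat _

/-! ### `τ³ = 1 ≠ τ`, `σ² = -1`, `στσ⁻¹ = τ⁻¹` -/

/-- `τ² = τ⁻¹`. [folklore] -/
theorem tau_sq : tau ^ 2 = tau⁻¹ :=
  enc_injective (by rw [pow_two, enc_mul, enc_tau, enc_tau_inv, M2.tau_mul_tau])

/-- **`τ³ = 1`.** [cite: BCDTJAMS2001, §2.2 (proof of Thm. 2.2.1, p. 860)] -/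
theorem tau_pow_three : tau ^ 3 = 1 := by
  rw [pow_succ, tau_sq, inv_mul_cancel]

/-- **`τ ≠ 1`.** [cite: BCDTJAMS2001, §2.2 (proof of Thm. 2.2.1, p. 860)] -/
theorem tau_ne_one : tau ≠ 1 := fun h ↦
  M2.tau_ne_one (by rw [← enc_tau, ← enc_one, h])

/-- `τ` has order `3`. [folklore] -/
theorem orderOf_tau : orderOf tau = 3 :=
  orderOf_eq_prime tau_pow_three tau_ne_one

/-- **`σ² = -1`.** [cite: BCDTJAMS2001, §2.2 (proof of Thm. 2.2.1, p. 860)] -/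
theorem sigma_sq : sigma ^ 2 = -1 :=
  enc_injective (by rw [pow_two, enc_mul, enc_sigma, M2.sigma_mul_sigma, enc_neg, enc_one])

/-- **`στσ⁻¹ = τ⁻¹`.** [cite: BCDTJAMS2001, §2.2 (proof of Thm. 2.2.1, p. 860)] -/
theorem sigma_mul_tau_mul_sigma_inv : sigma * tau * sigma⁻¹ = tau⁻¹ := by
  rw [mul_inv_eq_iff_eq_mul, ← tau_sq, pow_two]
  refine enc_injective ?_
  rw [enc_mul, enc_mul, enc_mul, enc_sigma, enc_tau, M2.sigma_mul_tau, M2.tau_mul_tau]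

/-- `σ⁻¹τσ = τ⁻¹` as well. [folklore] -/
theorem sigma_inv_mul_tau_mul_sigma : sigma⁻¹ * tau * sigma = tau⁻¹ := by
  have h : tau = sigma⁻¹ * tau⁻¹ * sigma := by
    rw [← sigma_mul_tau_mul_sigma_inv]; group
  conv_rhs => rw [h]
  group

/-- `σ⁻¹τ⁻¹σ = τ`. [folklore] -/
theorem sigma_inv_mul_tau_inv_mul_sigma : sigma⁻¹ * tau⁻¹ * sigma = tau := by
  conv_rhs => rw [← inv_inv tau, ← sigma_inv_mul_tau_mul_sigma]
  group

/-- `det τ = 1`. [folklore] -/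
theorem det_tau : Matrix.GeneralLinearGroup.det tau = 1 :=
  Units.ext (by rw [Matrix.GeneralLinearGroup.val_det_apply, val_tau, M2.det_toMat, M2.det_tau,
    Units.val_one])

/-- `det σ = 1`. [folklore] -/
theorem det_sigma : Matrix.GeneralLinearGroup.det sigma = 1 :=
  Units.ext (by rw [Matrix.GeneralLinearGroup.val_det_apply, val_sigma, M2.det_toMat, M2.det_sigma,
    Units.val_one])

/-! ## Elements of order `3` are conjugate to `τ` -/

/-- **An element `g ≠ 1` of `GL₂(𝔽₅)` with `g³ = 1` has trace `-1` and determinant `1`**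
(its minimal polynomial is `X² + X + 1`). [folklore] -/
theorem trace_and_det_of_pow_three_eq_one {g : GL (Fin 2) (ZMod 5)} (h3 : g ^ 3 = 1) (h1 : g ≠ 1) :
    (g : Matrix (Fin 2) (Fin 2) (ZMod 5)).trace = -1 ∧ (g : Matrix (Fin 2) (Fin 2) (ZMod 5)).det = 1 := by
  have hcube : M2.mul (enc g) (M2.mul (enc g) (enc g)) = M2.one := by
    rw [← enc_mul, ← enc_mul, ← enc_one, ← h3, pow_succ, pow_two, mul_assoc]
  rcases M2.cube_cert (enc g).a (enc g).b (enc g).c (enc g).d hcube with h | ⟨htr, hdet⟩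
  · exact absurd (enc_injective (h.trans enc_one.symm)) h1
  · constructor
    · rw [← toMat_enc g, M2.trace_toMat]; exact htr
    · rw [← toMat_enc g, M2.det_toMat]; exact hdet

/-- **Every element of order `3` of `GL₂(𝔽₅)` is conjugate to `τ`** (change of basis to
`(e₁, g e₁)`, in which `g` becomes the companion matrix of `X² + X + 1`). This is the "independence
of the choice of `τ`" of BCDT, p. 860. [cite: BCDTJAMS2001, §2.2 (proof of Thm. 2.2.1, p. 860)] -/
theorem exists_conj_eq_tau {g : GL (Fin 2) (ZMod 5)} (h3 : g ^ 3 = 1) (h1 : g ≠ 1) :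
    ∃ x : GL (Fin 2) (ZMod 5), x * g * x⁻¹ = tau := by
  obtain ⟨htr, hdet⟩ := trace_and_det_of_pow_three_eq_one h3 h1
  rw [← toMat_enc g, M2.trace_toMat] at htr
  rw [← toMat_enc g, M2.det_toMat] at hdet
  obtain ⟨hc, hmul⟩ := M2.conj_cert (enc g).a (enc g).b (enc g).c (enc g).d htr hdet
  -- the change of basis `B = (e₁ | g e₁)`, invertible since `det B = c ≠ 0`
  have hBdet : (M2.basisMat (enc g)).toMat.det ≠ 0 := by
    rw [M2.det_toMat]
    simpa [M2.det, M2.basisMat] using hc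
  let y : GL (Fin 2) (ZMod 5) := Matrix.GeneralLinearGroup.mkOfDetNeZero _ hBdet
  have hy : (y : Matrix (Fin 2) (Fin 2) (ZMod 5)) = (M2.basisMat (enc g)).toMat := rfl
  have hgy : g * y = y * tau := by
    refine Units.ext ?_
    rw [Units.val_mul, Units.val_mul, hy, ← toMat_enc g, val_tau, ← M2.toMat_mul, ← M2.toMat_mul]
    exact congrArg M2.toMat hmul
  refine ⟨y⁻¹, ?_⟩
  rw [inv_inv, mul_assoc, hgy, inv_mul_cancel_left]

/-- **Any two elements of order `3` of `GL₂(𝔽₅)` are conjugate** ("The following classification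
will be independent of the choice of `τ`", BCDT p. 860).
[cite: BCDTJAMS2001, §2.2 (proof of Thm. 2.2.1, p. 860)] -/
theorem isConj_of_pow_three_eq_one {g h : GL (Fin 2) (ZMod 5)} (hg3 : g ^ 3 = 1) (hg1 : g ≠ 1)
    (hh3 : h ^ 3 = 1) (hh1 : h ≠ 1) : IsConj g h := by
  obtain ⟨x, hx⟩ := exists_conj_eq_tau hg3 hg1
  obtain ⟨y, hy⟩ := exists_conj_eq_tau hh3 hh1
  have hg : IsConj g tau := isConj_iff.mpr ⟨x, hx⟩
  have hh : IsConj h tau := isConj_iff.mpr ⟨y, hy⟩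
  exact hg.trans hh.symm

/-! ## `𝔽₅(τ)^×` is the centraliser of `τ` -/

/-- `g ∈ 𝔽₅(τ)^×` iff `g τ = τ g`. [folklore] -/
theorem mem_unitsF5Tau_iff_mul_eq (g : GL (Fin 2) (ZMod 5)) : g ∈ unitsF5Tau ↔ g * tau = tau * g := by
  simp only [unitsF5Tau, Subgroup.mem_centralizer_iff, Set.mem_singleton_iff, forall_eq]
  exact ⟨fun h ↦ h.symm, fun h ↦ h.symm⟩

/-- An element of `𝔽₅(τ)^×` is encoded by some `a + cτ`, and conversely. [folklore] -/
theorem mem_unitsF5Tau_iff_exists_enc_eq (g : GL (Fin 2) (ZMod 5)) :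
    g ∈ unitsF5Tau ↔ ∃ a c : ZMod 5, enc g = M2.lin a c := by
  rw [mem_unitsF5Tau_iff_mul_eq, enc_injective.eq_iff.symm, enc_mul, enc_mul, enc_tau]
  constructor
  · intro h
    obtain ⟨hb, hd⟩ := (M2.comm_cert (enc g).a (enc g).b (enc g).c (enc g).d).mp h
    refine ⟨(enc g).a, (enc g).c, ?_⟩
    change (⟨(enc g).a, (enc g).b, (enc g).c, (enc g).d⟩ : M2) = _
    rw [hb, hd]; rfl
  · rintro ⟨a, c, hg⟩
    rw [hg]
    exact (M2.comm_cert a (-c) c (a - c)).mpr ⟨rfl, rfl⟩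

/-- **`𝔽₅(τ)^× = C_{GL₂(𝔽₅)}(τ) = {a + cτ : (a, c) ≠ (0, 0)}`**: an invertible matrix commutes with
`τ` iff it lies in the `𝔽₅`-algebra `𝔽₅[τ] = 𝔽₅ ⊕ 𝔽₅τ ≅ 𝔽₂₅` generated by `τ`. [folklore] -/
theorem mem_unitsF5Tau_iff (g : GL (Fin 2) (ZMod 5)) :
    g ∈ unitsF5Tau ↔ ∃ a c : ZMod 5, (g : Matrix (Fin 2) (Fin 2) (ZMod 5)) =
      a • (1 : Matrix (Fin 2) (Fin 2) (ZMod 5)) + c • (tau : Matrix (Fin 2) (Fin 2) (ZMod 5)) := by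
  rw [mem_unitsF5Tau_iff_exists_enc_eq]
  refine exists_congr fun a ↦ exists_congr fun c ↦ ?_
  rw [val_tau, M2.smul_one_add_smul_toMat_tau, ← M2.toMat_injective.eq_iff, toMat_enc]

/-- **`𝔽₅(τ)^×` is abelian** (it is `𝔽₂₅^×`). [folklore] -/
theorem mul_comm_of_mem_unitsF5Tau {g h : GL (Fin 2) (ZMod 5)} (hg : g ∈ unitsF5Tau)
    (hh : h ∈ unitsF5Tau) : g * h = h * g := by
  obtain ⟨a, c, hg'⟩ := (mem_unitsF5Tau_iff_exists_enc_eq g).mp hg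
  obtain ⟨a', c', hh'⟩ := (mem_unitsF5Tau_iff_exists_enc_eq h).mp hh
  refine enc_injective ?_
  rw [enc_mul, enc_mul, hg', hh']
  exact M2.lin_comm_cert a c a' c'

/-- **The elements of `𝔽₅(τ)^×` of determinant `1` are `±1, ±τ, ±τ²`.** [folklore] -/
theorem mem_six_of_mem_unitsF5Tau_of_det_eq_one {g : GL (Fin 2) (ZMod 5)} (hg : g ∈ unitsF5Tau)
    (hdet : Matrix.GeneralLinearGroup.det g = 1) :
    g = 1 ∨ g = -1 ∨ g = tau ∨ g = -tau ∨ g = tau ^ 2 ∨ g = -tau ^ 2 := by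
  obtain ⟨a, c, hg'⟩ := (mem_unitsF5Tau_iff_exists_enc_eq g).mp hg
  have hdet' : M2.det (M2.lin a c) = 1 := by
    rw [← hg', ← M2.det_toMat, toMat_enc, ← Matrix.GeneralLinearGroup.val_det_apply, hdet, Units.val_one]
  have key : ∀ u : GL (Fin 2) (ZMod 5), enc u = M2.lin a c → g = u :=
    fun u hu ↦ enc_injective (hg'.trans hu.symm)
  obtain ⟨h1, h2, h3, h4, h5, h6⟩ := M2.lin_six_cert
  rcases M2.det_one_cert a c hdet' with ⟨rfl, rfl⟩ | ⟨rfl, rfl⟩ | ⟨rfl, rfl⟩ | ⟨rfl, rfl⟩ |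
      ⟨rfl, rfl⟩ | ⟨rfl, rfl⟩
  · exact Or.inl (key 1 (by rw [enc_one, h1]))
  · exact Or.inr (Or.inl (key _ (by rw [enc_neg, enc_one, h2])))
  · exact Or.inr (Or.inr (Or.inl (key _ (by rw [enc_tau, h3]))))
  · exact Or.inr (Or.inr (Or.inr (Or.inl (key _ (by rw [enc_neg, enc_tau, h4])))))
  · exact Or.inr (Or.inr (Or.inr (Or.inr (Or.inl (key _ (by rw [tau_sq, enc_tau_inv, h5]))))))
  · exact Or.inr (Or.inr (Or.inr (Or.inr (Or.inr (key _ (by rw [enc_neg, tau_sq, enc_tau_inv, h6]))))))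

/-! ## General group theory: normalising `⟨s⟩` and normalising `C(s)` -/

/-- Membership in `⟨g⟩` for an element `g` of order `3`. [folklore] -/
theorem mem_zpowers_iff_of_orderOf_eq_three {G : Type*} [Group G] {g h : G} (hg : orderOf g = 3) :
    h ∈ Subgroup.zpowers g ↔ h = 1 ∨ h = g ∨ h = g ^ 2 := by
  constructor
  · intro hh
    obtain ⟨k, rfl⟩ := Subgroup.mem_zpowers_iff.mp hh
    rw [← zpow_mod_orderOf, hg]
    have h0 : 0 ≤ k % ((3 : ℕ) : ℤ) := Int.emod_nonneg k (by norm_num)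
    have h3 : k % ((3 : ℕ) : ℤ) < 3 := Int.emod_lt_of_pos k (by norm_num)
    generalize k % ((3 : ℕ) : ℤ) = m at h0 h3
    interval_cases m
    · exact Or.inl (zpow_zero g)
    · exact Or.inr (Or.inl (zpow_one g))
    · exact Or.inr (Or.inr (zpow_ofNat g 2))
  · rintro (h1 | h2 | h3)
    · rw [h1]; exact one_mem _
    · rw [h2]; exact Subgroup.mem_zpowers g
    · rw [h3]; exact pow_mem (Subgroup.mem_zpowers g) 2

/-- **Whoever normalises `⟨s⟩` normalises the centraliser `C(s)`**: if `h s h⁻¹` and `h⁻¹ s h` are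
powers of `s` then `h ∈ N(C(s))`. [folklore] -/
theorem mem_normalizer_centralizer_of_conj_mem_zpowers {G : Type*} [Group G] {s h : G}
    (h₁ : h * s * h⁻¹ ∈ Subgroup.zpowers s) (h₂ : h⁻¹ * s * h ∈ Subgroup.zpowers s) :
    h ∈ Subgroup.normalizer (Subgroup.centralizer ({s} : Set G) : Set G) := by
  rw [Subgroup.mem_normalizer_iff]
  intro c
  simp only [Subgroup.mem_centralizer_iff, Set.mem_singleton_iff, forall_eq]
  obtain ⟨k, hk⟩ := Subgroup.mem_zpowers_iff.mp h₁
  obtain ⟨m, hm⟩ := Subgroup.mem_zpowers_iff.mp h₂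
  constructor
  · intro hc
    -- `s = h s^m h⁻¹` and `c` commutes with `s ^ m`
    have hcm : s ^ m * c = c * s ^ m := (Commute.zpow_left hc m).eq
    have hs : s = h * s ^ m * h⁻¹ := by rw [hm]; group
    calc s * (h * c * h⁻¹) = h * s ^ m * h⁻¹ * (h * c * h⁻¹) := by rw [← hs]
      _ = h * (s ^ m * c) * h⁻¹ := by group
      _ = h * (c * s ^ m) * h⁻¹ := by rw [hcm]
      _ = h * c * h⁻¹ * (h * s ^ m * h⁻¹) := by group
      _ = h * c * h⁻¹ * s := by rw [← hs]
  · intro hc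
    -- `s = h⁻¹ s^k h` and `h c h⁻¹` commutes with `s ^ k`
    have hck : s ^ k * (h * c * h⁻¹) = h * c * h⁻¹ * s ^ k := (Commute.zpow_left hc k).eq
    have hs : s = h⁻¹ * s ^ k * h := by rw [hk]; group
    calc s * c = h⁻¹ * s ^ k * h * c := by rw [← hs]
      _ = h⁻¹ * (s ^ k * (h * c * h⁻¹)) * h := by group
      _ = h⁻¹ * (h * c * h⁻¹ * s ^ k) * h := by rw [hck]
      _ = c * (h⁻¹ * s ^ k * h) := by group
      _ = c * s := by rw [← hs]

/-- If `a s a⁻¹` and `a⁻¹ s a` are powers of `s` then `a` normalises `⟨s⟩`. [folklore] -/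
theorem mem_normalizer_zpowers_of_conj_mem {G : Type*} [Group G] {s a : G}
    (h₁ : a * s * a⁻¹ ∈ Subgroup.zpowers s) (h₂ : a⁻¹ * s * a ∈ Subgroup.zpowers s) :
    a ∈ Subgroup.normalizer (Subgroup.zpowers s : Set G) := by
  rw [Subgroup.mem_normalizer_iff]
  intro n
  constructor
  · intro hn
    obtain ⟨k, rfl⟩ := Subgroup.mem_zpowers_iff.mp hn
    rw [← conj_zpow]
    exact Subgroup.zpow_mem _ h₁ k
  · intro hn
    obtain ⟨k, hk⟩ := Subgroup.mem_zpowers_iff.mp hn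
    have hn' : n = a⁻¹ * s ^ k * a⁻¹⁻¹ := by rw [hk]; group
    rw [hn', ← conj_zpow]
    refine Subgroup.zpow_mem _ ?_ k
    rw [inv_inv]
    exact h₂

/-- The elements of a subgroup `H` normalising a subgroup `P` conjugate each `p ∈ P` into `P`, on
both sides. [folklore] -/
theorem conj_mem_and_inv_conj_mem_of_le_normalizer {G : Type*} [Group G] {H P : Subgroup G}
    (hHP : H ≤ Subgroup.normalizer (P : Set G)) {h : G} (hh : h ∈ H) {p : G} (hp : p ∈ P) :
    h * p * h⁻¹ ∈ P ∧ h⁻¹ * p * h ∈ P := by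
  refine ⟨(Subgroup.mem_normalizer_iff.mp (hHP hh) p).mp hp, ?_⟩
  have := (Subgroup.mem_normalizer_iff.mp (hHP (inv_mem hh)) p).mp hp
  rwa [inv_inv] at this

/-! ## Fact 1: subgroups with a non-trivial normal `3`-subgroup -/

/-- `#GL₂(𝔽₅) = (25 - 1)(25 - 5) = 480` (Mathlib `Matrix.card_GL_field`). [folklore] -/
theorem card_GL_fin_two_zmod_five : Nat.card (GL (Fin 2) (ZMod 5)) = 480 := by
  rw [Matrix.card_GL_field (𝔽 := ZMod 5) 2, Fin.prod_univ_two, ZMod.card]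
  norm_num

/-- **A non-trivial `3`-subgroup of `GL₂(𝔽₅)` has order `3`** (`9 ∤ 480`). [folklore] -/
theorem card_eq_three_of_isPGroup_three {P : Subgroup (GL (Fin 2) (ZMod 5))} (hP : IsPGroup 3 P)
    (hP1 : P ≠ ⊥) : Nat.card P = 3 := by
  obtain ⟨n, hn⟩ := IsPGroup.iff_card.mp hP
  have hdvd : Nat.card P ∣ 480 := card_GL_fin_two_zmod_five ▸ Subgroup.card_subgroup_dvd_card P
  rw [hn] at hdvd ⊢
  have hn0 : n ≠ 0 := by
    rintro rfl
    exact hP1 ((Subgroup.eq_bot_iff_card P).mpr (by rw [hn, pow_zero]))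
  have hn2 : n < 2 := by
    by_contra hle
    have h9 : 3 ^ 2 ∣ 480 := (pow_dvd_pow 3 (not_lt.mp hle)).trans hdvd
    exact absurd h9 (by decide)
  interval_cases n
  · exact absurd rfl hn0
  · rfl

/-- **A non-trivial `3`-subgroup of `GL₂(𝔽₅)` is generated by an element of order `3`.** [folklore] -/
theorem exists_eq_zpowers_of_isPGroup_three {P : Subgroup (GL (Fin 2) (ZMod 5))} (hP : IsPGroup 3 P)
    (hP1 : P ≠ ⊥) : ∃ g : GL (Fin 2) (ZMod 5), g ^ 3 = 1 ∧ g ≠ 1 ∧ P = Subgroup.zpowers g := by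
  have hcard := card_eq_three_of_isPGroup_three hP hP1
  obtain ⟨⟨g, hgP⟩, hg1⟩ := Subgroup.ne_bot_iff_exists_ne_one.mp hP1
  have hg1' : g ≠ 1 := fun h ↦ hg1 (Subtype.ext h)
  have hg3 : g ^ 3 = 1 := by
    have h := pow_card_eq_one' (G := P) (x := ⟨g, hgP⟩)
    rw [hcard] at h
    exact congrArg Subtype.val h
  refine ⟨g, hg3, hg1', ?_⟩
  have hz : Nat.card (Subgroup.zpowers g) = 3 := by rw [Nat.card_zpowers, orderOf_eq_prime hg3 hg1']
  exact (Subgroup.eq_of_le_of_card_ge (Subgroup.zpowers_le.mpr hgP) (hcard.trans hz.symm).le).symm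

/-- **BCDT's first fact** (p. 860): *"A subgroup of `GL₂(𝔽₅)` with a non-trivial normal subgroup
of `3`-power order is, up to conjugation, contained in the normaliser of `𝔽₅(τ)^×`."*  Precisely: if
`H ≤ GL₂(𝔽₅)` normalises a subgroup `P ≠ 1` all of whose elements have `3`-power order, then for
some `x ∈ GL₂(𝔽₅)` the conjugate `x H x⁻¹` lies in the normaliser of `𝔽₅(τ)^× = C(τ)` and
`x P x⁻¹ = ⟨τ⟩`.  Proof: `#P = 3` (`9 ∤ 480`), `P = ⟨g⟩` with `g` conjugate to `τ`
(`exists_conj_eq_tau`), and an element normalising `⟨τ⟩` normalises `C(τ)`.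
[cite: BCDTJAMS2001, §2.2 (proof of Thm. 2.2.1, p. 860, first bullet)] -/
theorem exists_conj_le_normalizer_unitsF5Tau {H P : Subgroup (GL (Fin 2) (ZMod 5))}
    (hHP : H ≤ Subgroup.normalizer (P : Set (GL (Fin 2) (ZMod 5)))) (hP : IsPGroup 3 P) (hP1 : P ≠ ⊥) :
    ∃ x : GL (Fin 2) (ZMod 5),
      H.map (MulAut.conj x).toMonoidHom ≤
          Subgroup.normalizer (unitsF5Tau : Set (GL (Fin 2) (ZMod 5))) ∧
        P.map (MulAut.conj x).toMonoidHom = Subgroup.zpowers tau := by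
  obtain ⟨g, hg3, hg1, rfl⟩ := exists_eq_zpowers_of_isPGroup_three hP hP1
  obtain ⟨x, hx⟩ := exists_conj_eq_tau hg3 hg1
  refine ⟨x, ?_, by rw [MonoidHom.map_zpowers]; exact congrArg Subgroup.zpowers hx⟩
  rintro _ ⟨h, hh, rfl⟩
  change x * h * x⁻¹ ∈ _
  obtain ⟨hc1, hc2⟩ := conj_mem_and_inv_conj_mem_of_le_normalizer hHP hh (Subgroup.mem_zpowers g)
  refine mem_normalizer_centralizer_of_conj_mem_zpowers ?_ ?_
  · obtain ⟨k, hk⟩ := Subgroup.mem_zpowers_iff.mp hc1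
    have e : x * h * x⁻¹ * tau * (x * h * x⁻¹)⁻¹ = x * (h * g * h⁻¹) * x⁻¹ := by rw [← hx]; group
    rw [e, ← hk, ← conj_zpow, hx]
    exact Subgroup.zpow_mem _ (Subgroup.mem_zpowers tau) k
  · obtain ⟨k, hk⟩ := Subgroup.mem_zpowers_iff.mp hc2
    have e : (x * h * x⁻¹)⁻¹ * tau * (x * h * x⁻¹) = x * (h⁻¹ * g * h) * x⁻¹ := by rw [← hx]; group
    rw [e, ← hk, ← conj_zpow, hx]
    exact Subgroup.zpow_mem _ (Subgroup.mem_zpowers tau) k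

/-- **Fact 1 for a homomorphism** — the form in which BCDT apply it to `ρ̄(G₃)` and its normal
subgroup `ρ̄(P₃)` (image of wild inertia): if `ρ : D → GL₂(𝔽₅)` is a homomorphism and `P ⊴ D` a
normal subgroup whose image is a non-trivial group of elements of `3`-power order, then after
conjugating `ρ` by some `x ∈ GL₂(𝔽₅)`, `ρ(D) ≤ N(𝔽₅(τ)^×)` and `ρ(P) = ⟨τ⟩`.
[cite: BCDTJAMS2001, §2.2 (proof of Thm. 2.2.1, p. 860, first bullet)] -/
theorem exists_conj_apply_mem_normalizer_of_normal {D : Type*} [Group D]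
    (ρ : D →* GL (Fin 2) (ZMod 5)) (P : Subgroup D) [P.Normal] (hP : IsPGroup 3 (P.map ρ))
    (hP1 : P.map ρ ≠ ⊥) :
    ∃ x : GL (Fin 2) (ZMod 5),
      (∀ d : D, x * ρ d * x⁻¹ ∈ Subgroup.normalizer (unitsF5Tau : Set (GL (Fin 2) (ZMod 5)))) ∧
        P.map ((MulAut.conj x).toMonoidHom.comp ρ) = Subgroup.zpowers tau := by
  have hle : ρ.range ≤ Subgroup.normalizer (P.map ρ : Set (GL (Fin 2) (ZMod 5))) := by
    rw [MonoidHom.range_eq_map, ← Subgroup.normalizer_eq_top P]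
    exact Subgroup.le_normalizer_map ρ
  obtain ⟨x, hH, hPx⟩ := exists_conj_le_normalizer_unitsF5Tau hle hP hP1
  refine ⟨x, fun d ↦ hH ⟨ρ d, ⟨d, rfl⟩, rfl⟩, ?_⟩
  rw [← Subgroup.map_map, hPx]

/-! ## Fact 2: `SL₂(𝔽₅) ∩ N(⟨τ⟩) = ⟨τ, σ⟩` -/

/-- `-1 = σ² ∈ ⟨τ, σ⟩`. [folklore] -/
theorem neg_one_mem_closure : (-1 : GL (Fin 2) (ZMod 5)) ∈ Subgroup.closure {tau, sigma} := by
  rw [← sigma_sq]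
  exact pow_mem (Subgroup.subset_closure (by simp)) 2

/-- The six elements `±1, ±τ, ±τ²` lie in `⟨τ, σ⟩`. [folklore] -/
theorem mem_closure_of_mem_six {g : GL (Fin 2) (ZMod 5)}
    (hg : g = 1 ∨ g = -1 ∨ g = tau ∨ g = -tau ∨ g = tau ^ 2 ∨ g = -tau ^ 2) :
    g ∈ Subgroup.closure ({tau, sigma} : Set (GL (Fin 2) (ZMod 5))) := by
  have ht : tau ∈ Subgroup.closure ({tau, sigma} : Set (GL (Fin 2) (ZMod 5))) :=
    Subgroup.subset_closure (by simp)
  have hneg : ∀ u : GL (Fin 2) (ZMod 5), -u = -1 * u := fun u ↦ by rw [neg_mul, one_mul]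
  rcases hg with rfl | rfl | rfl | rfl | rfl | rfl
  · exact one_mem _
  · exact neg_one_mem_closure
  · exact ht
  · rw [hneg]; exact mul_mem neg_one_mem_closure ht
  · exact pow_mem ht 2
  · rw [hneg]; exact mul_mem neg_one_mem_closure (pow_mem ht 2)

/-- **BCDT's second fact** (p. 860): *"The intersection of `SL₂(𝔽₅)` with the normaliser of `τ` in
`GL₂(𝔽₅)` is generated by `τ` and an element `σ` such that `σ² = -1` and `στσ⁻¹ = τ⁻¹`."*  Here
`SL₂(𝔽₅)` is the kernel of `det : GL₂(𝔽₅) → 𝔽₅^×`, the normaliser of `τ` is that of `⟨τ⟩`, and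
`σ = (0 2; 2 0)` (`sigma_sq`, `sigma_mul_tau_mul_sigma_inv`); the intersection has order `12`.
Proof: an element `g` of the intersection conjugates `τ` to `τ` or `τ⁻¹`; replacing `g` by `σ⁻¹ g`
in the second case, `g` centralises `τ` and has determinant `1`, so `g ∈ {±1, ±τ, ±τ²} ⊂ ⟨τ, σ⟩`.
[cite: BCDTJAMS2001, §2.2 (proof of Thm. 2.2.1, p. 860, second bullet)] -/
theorem ker_det_inf_normalizer_zpowers_tau :
    (Matrix.GeneralLinearGroup.det : GL (Fin 2) (ZMod 5) →* (ZMod 5)ˣ).ker ⊓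
        Subgroup.normalizer (Subgroup.zpowers tau : Set (GL (Fin 2) (ZMod 5))) =
      Subgroup.closure {tau, sigma} := by
  refine le_antisymm ?_ ((Subgroup.closure_le _).mpr ?_)
  · intro g hg
    obtain ⟨hdet, hN⟩ := Subgroup.mem_inf.mp hg
    rw [MonoidHom.mem_ker] at hdet
    have hconj : g * tau * g⁻¹ ∈ Subgroup.zpowers tau :=
      (Subgroup.mem_normalizer_iff.mp hN tau).mp (Subgroup.mem_zpowers tau)
    rcases (mem_zpowers_iff_of_orderOf_eq_three orderOf_tau).mp hconj with h | h | h
    · exact absurd (conj_eq_one_iff.mp h) tau_ne_one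
    · -- `g` centralises `τ`
      have hg' : g ∈ unitsF5Tau := by
        rw [mem_unitsF5Tau_iff_mul_eq, ← mul_inv_eq_iff_eq_mul, h]
      exact mem_closure_of_mem_six (mem_six_of_mem_unitsF5Tau_of_det_eq_one hg' hdet)
    · -- `σ⁻¹ g` centralises `τ`
      rw [tau_sq] at h
      have hg' : sigma⁻¹ * g ∈ unitsF5Tau := by
        rw [mem_unitsF5Tau_iff_mul_eq]
        calc sigma⁻¹ * g * tau = sigma⁻¹ * (g * tau * g⁻¹) * g := by group
          _ = sigma⁻¹ * tau⁻¹ * sigma * (sigma⁻¹ * g) := by rw [h]; group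
          _ = tau * (sigma⁻¹ * g) := by rw [sigma_inv_mul_tau_inv_mul_sigma]
      have hdet' : Matrix.GeneralLinearGroup.det (sigma⁻¹ * g) = 1 := by
        rw [map_mul, map_inv, det_sigma, hdet, inv_one, one_mul]
      have hmem := mem_closure_of_mem_six (mem_six_of_mem_unitsF5Tau_of_det_eq_one hg' hdet')
      have hσ : sigma ∈ Subgroup.closure ({tau, sigma} : Set (GL (Fin 2) (ZMod 5))) :=
        Subgroup.subset_closure (by simp)
      have := mul_mem hσ hmem
      rwa [mul_inv_cancel_left] at this
  · intro u hu
    rw [SetLike.mem_coe, Subgroup.mem_inf, MonoidHom.mem_ker]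
    simp only [Set.mem_insert_iff, Set.mem_singleton_iff] at hu
    rcases hu with rfl | rfl
    · exact ⟨det_tau, Subgroup.le_normalizer (Subgroup.mem_zpowers _)⟩
    · refine ⟨det_sigma, mem_normalizer_zpowers_of_conj_mem ?_ ?_⟩
      · rw [sigma_mul_tau_mul_sigma_inv]; exact inv_mem (Subgroup.mem_zpowers _)
      · rw [sigma_inv_mul_tau_mul_sigma]; exact inv_mem (Subgroup.mem_zpowers _)

/-- **Fact 2, as printed** (existential form): there is `σ ∈ GL₂(𝔽₅)` with `σ² = -1`,
`στσ⁻¹ = τ⁻¹`, and `SL₂(𝔽₅) ∩ N(⟨τ⟩) = ⟨τ, σ⟩`.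
[cite: BCDTJAMS2001, §2.2 (proof of Thm. 2.2.1, p. 860, second bullet)] -/
theorem exists_sigma_ker_det_inf_normalizer_eq_closure :
    ∃ σ : GL (Fin 2) (ZMod 5), σ ^ 2 = -1 ∧ σ * tau * σ⁻¹ = tau⁻¹ ∧
      (Matrix.GeneralLinearGroup.det : GL (Fin 2) (ZMod 5) →* (ZMod 5)ˣ).ker ⊓
          Subgroup.normalizer (Subgroup.zpowers tau : Set (GL (Fin 2) (ZMod 5))) =
        Subgroup.closure {tau, σ} :=
  ⟨sigma, sigma_sq, sigma_mul_tau_mul_sigma_inv, ker_det_inf_normalizer_zpowers_tau⟩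

/-! ## Fact 3: `α ∈ 𝔽₅(τ)^×`, `det α = 3`, `σασ⁻¹ = -α` forces `α = ±(τ - τ⁻¹)` -/

/-- **BCDT's third fact** (p. 860): *"If `α ∈ 𝔽₅(τ)^×`, `det α = 3`, and `σασ⁻¹ = -α`, then
`α = ±(τ - τ⁻¹)`."*  Here `α ∈ 𝔽₅(τ)^× = C(τ)`, and `σ'` is ANY element with `σ'τσ'⁻¹ = τ⁻¹` (e.g.
the `σ` of fact 2): since `σ⁻¹σ'` centralises `τ` and `𝔽₅(τ)^×` is abelian, `σ'ασ'⁻¹ = σασ⁻¹`, and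
the condition `σα = -ασ` with `det α = 3` leaves `α = ±(1 + 2τ) = ±(τ - τ⁻¹)` (a `25`-case check).
The conclusion is an identity of matrices (`τ - τ⁻¹ = (1 -2; 2 -1)`).
[cite: BCDTJAMS2001, §2.2 (proof of Thm. 2.2.1, p. 860, third bullet)] -/
theorem eq_tau_sub_tau_inv_or_of_det_eq_three {α σ' : GL (Fin 2) (ZMod 5)} (hα : α ∈ unitsF5Tau)
    (hdet : (α : Matrix (Fin 2) (Fin 2) (ZMod 5)).det = 3) (hσ' : σ' * tau * σ'⁻¹ = tau⁻¹)
    (hσ'α : σ' * α * σ'⁻¹ = -α) :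
    (α : Matrix (Fin 2) (Fin 2) (ZMod 5)) =
        (tau : Matrix (Fin 2) (Fin 2) (ZMod 5)) - ((tau⁻¹ : GL (Fin 2) (ZMod 5)) : Matrix (Fin 2) (Fin 2) (ZMod 5)) ∨
      (α : Matrix (Fin 2) (Fin 2) (ZMod 5)) =
        -((tau : Matrix (Fin 2) (Fin 2) (ZMod 5)) - ((tau⁻¹ : GL (Fin 2) (ZMod 5)) : Matrix (Fin 2) (Fin 2) (ZMod 5))) := by
  -- `c₀ = σ⁻¹ σ'` centralises `τ`
  have hc₀ : sigma⁻¹ * σ' ∈ unitsF5Tau := by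
    rw [mem_unitsF5Tau_iff_mul_eq]
    have key : σ' * tau * σ'⁻¹ = sigma * tau * sigma⁻¹ := by rw [hσ', sigma_mul_tau_mul_sigma_inv]
    calc sigma⁻¹ * σ' * tau = sigma⁻¹ * (σ' * tau * σ'⁻¹) * σ' := by group
      _ = sigma⁻¹ * (sigma * tau * sigma⁻¹) * σ' := by rw [key]
      _ = tau * (sigma⁻¹ * σ') := by group
  -- hence `σ α σ⁻¹ = σ' α σ'⁻¹ = -α`
  have hcomm : sigma⁻¹ * σ' * α = α * (sigma⁻¹ * σ') := mul_comm_of_mem_unitsF5Tau hc₀ hα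
  have hσα : sigma * α * sigma⁻¹ = -α := by
    have hc : sigma⁻¹ * σ' * α * (sigma⁻¹ * σ')⁻¹ = α := by rw [hcomm]; group
    calc sigma * α * sigma⁻¹ = sigma * (sigma⁻¹ * σ' * α * (sigma⁻¹ * σ')⁻¹) * sigma⁻¹ := by rw [hc]
      _ = σ' * α * σ'⁻¹ := by group
      _ = -α := hσ'α
  -- read off on the model
  obtain ⟨a, c, hαenc⟩ := (mem_unitsF5Tau_iff_exists_enc_eq α).mp hα
  have hdet' : M2.det (M2.lin a c) = 3 := by rw [← hαenc, ← M2.det_toMat, toMat_enc, hdet]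
  have hmul : M2.mul M2.sigma (M2.lin a c) = M2.mul (M2.neg (M2.lin a c)) M2.sigma := by
    rw [mul_inv_eq_iff_eq_mul] at hσα
    have h := congrArg enc hσα
    rwa [enc_mul, enc_mul, enc_neg, enc_sigma, hαenc] at h
  have hαval : (α : Matrix (Fin 2) (Fin 2) (ZMod 5)) = M2.toMat (M2.lin a c) := by rw [← hαenc, toMat_enc]
  rw [hαval, val_tau, val_tau_inv]
  rcases M2.fact3_cert a c hdet' hmul with ⟨rfl, rfl⟩ | ⟨rfl, rfl⟩
  · exact Or.inl M2.toMat_lin_one_two.1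
  · exact Or.inr M2.toMat_lin_one_two.2

/-- `τ - τ⁻¹ = (1 -2; 2 -1) = 1 + 2τ`. [folklore] -/
theorem val_tau_sub_val_tau_inv :
    (tau : Matrix (Fin 2) (Fin 2) (ZMod 5)) - ((tau⁻¹ : GL (Fin 2) (ZMod 5)) : Matrix (Fin 2) (Fin 2) (ZMod 5)) =
      !![1, -2; 2, -1] := by
  rw [val_tau, val_tau_inv, ← M2.toMat_lin_one_two.1]; rfl

/-! ## Appendix: `N(𝔽₅(τ)^×) = 𝔽₅(τ)^× ∪ σ 𝔽₅(τ)^×` (the index-`2` dichotomy)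

The normaliser of the non-split Cartan subgroup `𝔽₅(τ)^×` is `𝔽₅(τ)^× ⋊ ⟨σ⟩`-shaped: an element
normalising `𝔽₅(τ)^×` either centralises `τ` or differs from `σ` by an element centralising `τ`
(`σ` acting on `𝔽₅(τ) ≅ 𝔽₂₅` as the Frobenius).  In BCDT's classification this is the split between
case 2 (`ρ̄(G₃) ≤ 𝔽₅(τ)^×`: "`ρ̄|_{G₃}` is given by a character `ℚ₃^× → 𝔽₅(τ)^×`") and cases 3–6
(`ρ̄(G₃) ≰ 𝔽₅(τ)^×`: the index-`2` subgroup `ρ̄⁻¹(𝔽₅(τ)^×) = G_M`, `M = ℚ₃(√-1), ℚ₃(√±3)`, on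
which `ρ̄` is a character). -/

namespace M2

/-- **The elements of `𝔽₅(τ)^×` of order dividing `3` are `1, τ, τ²`** (`μ₃ ⊂ 𝔽₂₅^×`). [folklore] -/
theorem lin_cube_cert : ∀ a c : ZMod 5, mul (lin a c) (mul (lin a c) (lin a c)) = one →
    (a = 1 ∧ c = 0) ∨ (a = 0 ∧ c = 1) ∨ (a = -1 ∧ c = -1) := by
  decide

end M2

/-- `τ ∈ 𝔽₅(τ)^×`. [folklore] -/
theorem tau_mem_unitsF5Tau : tau ∈ unitsF5Tau :=
  (mem_unitsF5Tau_iff_mul_eq tau).mpr rfl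

/-- `⟨τ⟩ ≤ 𝔽₅(τ)^×`. [folklore] -/
theorem zpowers_tau_le_unitsF5Tau : Subgroup.zpowers tau ≤ unitsF5Tau :=
  Subgroup.zpowers_le.mpr tau_mem_unitsF5Tau

/-- **The elements of order `3` of `𝔽₅(τ)^×` are `τ` and `τ² = τ⁻¹`.** [folklore] -/
theorem eq_tau_or_eq_tau_sq_of_mem_unitsF5Tau {g : GL (Fin 2) (ZMod 5)} (hg : g ∈ unitsF5Tau)
    (h3 : g ^ 3 = 1) (h1 : g ≠ 1) : g = tau ∨ g = tau ^ 2 := by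
  obtain ⟨a, c, hg'⟩ := (mem_unitsF5Tau_iff_exists_enc_eq g).mp hg
  have hcube : M2.mul (M2.lin a c) (M2.mul (M2.lin a c) (M2.lin a c)) = M2.one := by
    rw [← hg', ← enc_mul, ← enc_mul, ← enc_one, ← h3, pow_succ, pow_two, mul_assoc]
  obtain ⟨_, _, h3', _, h5, _⟩ := M2.lin_six_cert
  rcases M2.lin_cube_cert a c hcube with ⟨rfl, rfl⟩ | ⟨rfl, rfl⟩ | ⟨rfl, rfl⟩
  · exact absurd (enc_injective (hg'.trans (M2.lin_six_cert.1.trans enc_one.symm))) h1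
  · exact Or.inl (enc_injective (hg'.trans (h3'.trans enc_tau.symm)))
  · refine Or.inr (enc_injective (hg'.trans (h5.trans ?_)))
    rw [tau_sq, enc_tau_inv]

/-- If `g` conjugates `τ` to `τ⁻¹` then `σ⁻¹ g` centralises `τ`. [folklore] -/
theorem sigma_inv_mul_mem_unitsF5Tau_of_conj_eq {g : GL (Fin 2) (ZMod 5)}
    (h : g * tau * g⁻¹ = tau⁻¹) : sigma⁻¹ * g ∈ unitsF5Tau := by
  rw [mem_unitsF5Tau_iff_mul_eq]
  calc sigma⁻¹ * g * tau = sigma⁻¹ * (g * tau * g⁻¹) * g := by group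
    _ = sigma⁻¹ * tau⁻¹ * sigma * (sigma⁻¹ * g) := by rw [h]; group
    _ = tau * (sigma⁻¹ * g) := by rw [sigma_inv_mul_tau_inv_mul_sigma]

/-- `σ` normalises `𝔽₅(τ)^×` (it induces the Frobenius of `𝔽₂₅`). [folklore] -/
theorem sigma_mem_normalizer_unitsF5Tau :
    sigma ∈ Subgroup.normalizer (unitsF5Tau : Set (GL (Fin 2) (ZMod 5))) := by
  refine mem_normalizer_centralizer_of_conj_mem_zpowers ?_ ?_
  · rw [sigma_mul_tau_mul_sigma_inv]; exact inv_mem (Subgroup.mem_zpowers _)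
  · rw [sigma_inv_mul_tau_mul_sigma]; exact inv_mem (Subgroup.mem_zpowers _)

/-- `σ ∉ 𝔽₅(τ)^×` (`στσ⁻¹ = τ⁻¹ ≠ τ`), so `𝔽₅(τ)^×` is a proper subgroup of its normaliser.
[folklore] -/
theorem sigma_not_mem_unitsF5Tau : sigma ∉ unitsF5Tau := by
  intro h
  rw [mem_unitsF5Tau_iff_mul_eq, ← mul_inv_eq_iff_eq_mul, sigma_mul_tau_mul_sigma_inv, ← tau_sq,
    pow_two] at h
  exact tau_ne_one (mul_left_cancel (h.trans (mul_one tau).symm))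

/-- `𝔽₅(τ)^×` is contained in its normaliser. [folklore] -/
theorem unitsF5Tau_le_normalizer :
    unitsF5Tau ≤ Subgroup.normalizer (unitsF5Tau : Set (GL (Fin 2) (ZMod 5))) :=
  Subgroup.le_normalizer

/-- **`N(𝔽₅(τ)^×) = 𝔽₅(τ)^× ∪ σ 𝔽₅(τ)^×`**: an element `g` normalising `𝔽₅(τ)^×` conjugates `τ`
to an element of order `3` of `𝔽₅(τ)^×`, i.e. to `τ` (then `g ∈ 𝔽₅(τ)^×`) or to `τ⁻¹` (then
`σ⁻¹ g ∈ 𝔽₅(τ)^×`); so `𝔽₅(τ)^×` has index `2` in its normaliser, with `σ` representing the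
non-trivial coset (`sigma_mem_normalizer_unitsF5Tau`, `sigma_not_mem_unitsF5Tau`).  For BCDT's
`ρ̄(G₃) ≤ N(𝔽₅(τ)^×)` this is the split "case 2 (image inside `𝔽₅(τ)^×`) versus cases 3–6 (an
index-`2` subgroup `G_M` mapping into `𝔽₅(τ)^×`)".
[cite: BCDTJAMS2001, §2.2 (proof of Thm. 2.2.1, p. 860, cases 2–6)] -/
theorem mem_or_sigma_inv_mul_mem_of_mem_normalizer_unitsF5Tau {g : GL (Fin 2) (ZMod 5)}
    (hg : g ∈ Subgroup.normalizer (unitsF5Tau : Set (GL (Fin 2) (ZMod 5)))) :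
    g ∈ unitsF5Tau ∨ sigma⁻¹ * g ∈ unitsF5Tau := by
  have hconj : g * tau * g⁻¹ ∈ unitsF5Tau := (Subgroup.mem_normalizer_iff.mp hg tau).mp tau_mem_unitsF5Tau
  have h3 : (g * tau * g⁻¹) ^ 3 = 1 := by rw [conj_pow, tau_pow_three, mul_one, mul_inv_cancel]
  have h1 : g * tau * g⁻¹ ≠ 1 := fun h ↦ tau_ne_one (conj_eq_one_iff.mp h)
  rcases eq_tau_or_eq_tau_sq_of_mem_unitsF5Tau hconj h3 h1 with h | h
  · left
    rw [mem_unitsF5Tau_iff_mul_eq, ← mul_inv_eq_iff_eq_mul, h]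
  · right
    rw [tau_sq] at h
    exact sigma_inv_mul_mem_unitsF5Tau_of_conj_eq h

/-- **The coset dichotomy is multiplicative** (index `2`): if neither `g` nor `h` lies in
`𝔽₅(τ)^×` but both normalise it, then `g h ∈ 𝔽₅(τ)^×` (`σ c σ c' = σ² (σ⁻¹ c σ) c'` with
`σ² = -1 ∈ 𝔽₅(τ)^×`). [folklore] -/
theorem mul_mem_unitsF5Tau_of_not_mem_of_not_mem {g h : GL (Fin 2) (ZMod 5)}
    (hg : g ∈ Subgroup.normalizer (unitsF5Tau : Set (GL (Fin 2) (ZMod 5))))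
    (hh : h ∈ Subgroup.normalizer (unitsF5Tau : Set (GL (Fin 2) (ZMod 5))))
    (hg' : g ∉ unitsF5Tau) (hh' : h ∉ unitsF5Tau) : g * h ∈ unitsF5Tau := by
  have hgc := (mem_or_sigma_inv_mul_mem_of_mem_normalizer_unitsF5Tau hg).resolve_left hg'
  have hhc := (mem_or_sigma_inv_mul_mem_of_mem_normalizer_unitsF5Tau hh).resolve_left hh'
  -- `g h = σ (σ⁻¹ g) σ (σ⁻¹ h) = σ² · (σ⁻¹ (σ⁻¹ g) σ) · (σ⁻¹ h)`
  have hfrob : sigma⁻¹ * (sigma⁻¹ * g) * sigma ∈ unitsF5Tau := by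
    have := (Subgroup.mem_normalizer_iff''.mp sigma_mem_normalizer_unitsF5Tau (sigma⁻¹ * g)).mp hgc
    exact this
  have hneg : sigma ^ 2 ∈ unitsF5Tau := by
    rw [sigma_sq, mem_unitsF5Tau_iff_mul_eq, neg_one_mul, mul_neg_one]
  have e : g * h = sigma ^ 2 * (sigma⁻¹ * (sigma⁻¹ * g) * sigma) * (sigma⁻¹ * h) := by group
  rw [e]
  exact mul_mem (mul_mem hneg hfrob) hhc

end Literature.NumberTheory.GaloisRepresentations.GL2F5OrderThree
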